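import Literature.Analysis.Calculus.PeriodicMollifier
import Literature.Analysis.Calculus.LocalDegreeFormula
import Mathlib.Analysis.Calculus.BumpFunction.Normed
import Mathlib.Analysis.Calculus.LineDeriv.Basic
import Mathlib.Analysis.Calculus.Deriv.Shift
import Mathlib.MeasureTheory.Integral.Pi
import Mathlib.MeasureTheory.Integral.IntervalIntegral.FundThmCalculus
import Mathlib.Algebra.Order.ToIntervalMod
import Mathlib.Topology.Algebra.Module.Cardinality
import HarnessLib

/-!
# Poincaré–Hopf on the flat torus: the index sum of a periodic vector field vanishes

Topic `Literature/Topology/Euclidean`. Let `f : ℝⁿ⁺¹ → ℝⁿ⁺¹` (`ℝⁿ⁺¹ = Fin (n+1) → ℝ`, sup norm)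
be `C¹` and `T`-periodic in each coordinate, i.e. a `C¹` vector field on the flat torus
`ℝⁿ⁺¹ / Tℤⁿ⁺¹` (whose tangent bundle is trivial). If its zeros in a fundamental box are finitely
many and non-degenerate, then

  `∑_{f(z) = 0} sign det Df(z) = 0`

(`sum_sign_det_eq_zero_of_periodic`, zeros counted in the half-open box `∏ [aᵢ, aᵢ + T)`;
`sum_sign_det_eq_zero_of_zeros_interior`, zeros in the interior of a closed period box). This is
the Poincaré–Hopf theorem `∑ ind = χ(Tⁿ⁺¹) = 0` for the torus (Milnor, *Topology from the
differentiable viewpoint*, §6; Guillemin–Pollack Ch. 3 §5), equivalently the statement that the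
Brouwer degree of the Gauss-type map `f : Tⁿ⁺¹ → ℝⁿ⁺¹` at the value `0` vanishes because `f` is not
surjective. It is the topological input of the Nielsen–Ninomiya fermion-doubling theorem
(`Literature/Barriers/QuantumFields/NielsenNinomiya.lean`).

## Proof (analytic degree theory; Chang, *Methods in Nonlinear Analysis* (2005), §3.1)

Choose disjoint balls around the zeros inside the open box and `δ > 0` as in the local degree
formula (`Literature.Analysis.Calculus.setIntegral_comp_mul_det_eq_integral_mul_sum_sign`): for
every continuous weight `φ` supported in `‖v‖ < δ`, `∫_K φ(f) det Df = (∫ φ) ∑ sign det Df(z)`.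
Take `φ(v) = ∏ᵢ θ(vᵢ)` with `θ` a normalised one-dimensional bump of radius `δ/2` (`∫ φ = 1`), and
`G(v) = (Θ(v₀) - Θ(v₀ - R)) ∏_{i ≥ 1} θ(vᵢ) · e₀` with `Θ' = θ` and `R > sup_K ‖f‖ + δ`
(`exists_field_with_bump_divergence`): `G` is differentiable with
`div G (v) = φ(v) - φ(v - R e₀)`, and the second term vanishes on the range of `f`. Hence
`∑ sign det Df(z) = ∫_K φ(f) det Df = ∫_K (div G)(f) det Df = 0` by
`Literature.Analysis.Calculus.integral_divG_comp_mul_det_eq_zero` (null-Lagrangian identity,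
periodic divergence theorem, `C¹` mollification). The count over a half-open fundamental box is
reduced to the interior case by translating the box so that no zero lies on its boundary
(countably many excluded positions per coordinate) and matching zeros through reduction modulo
`T` (`toIcoMod`). No definitions, no `sorry`.

## References

* K.-C. Chang, *Methods in Nonlinear Analysis* (2005), §3.1–3.2 (Brouwer degree). [Chang2005]
* J. Milnor, *Topology from the Differentiable Viewpoint* (1965), §6 (Poincaré–Hopf). [Milnor1965]
* A. Wipf, *Statistical Approach to Quantum Field Theory*, 2nd ed. (2021), §15.3.5, (15.77)
  (`∑ index = χ(Tᵈ) = 0`, as used for Nielsen–Ninomiya). [Wipf2021]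
-/

noncomputable section

open MeasureTheory Set Function Metric Filter Literature.Analysis.Calculus
open scoped Topology ContDiff

namespace Literature.Topology.Euclidean

variable {n : ℕ}

/-! ### An explicit field whose divergence is a product bump near the origin -/

/-- **A compactly generated divergence.** For `δ > 0` and `R ∈ ℝ` there are a differentiable field
`G : ℝⁿ⁺¹ → ℝⁿ⁺¹` and continuous `φ, ψ : ℝⁿ⁺¹ → ℝ` with `div G = ψ`, `∫ φ = 1`, `φ = 0` on
`{‖v‖ ≥ δ}`, and `ψ(v) = φ(v)` whenever `v₀ + δ ≤ R`: namely `φ(v) = ∏ᵢ θ(vᵢ)`,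
`ψ(v) = (θ(v₀) - θ(v₀ - R)) ∏_{i≥1} θ(vᵢ)`, `G(v) = (Θ(v₀) - Θ(v₀ - R)) ∏_{i≥1} θ(vᵢ) · e₀`, with `θ`
a normalised smooth bump supported in `(-δ/2, δ/2)` and `Θ' = θ` (Chang 2005, Lemma 3.1.2, the
one-variable step of "`∫ ψ = 0 ⇒ ψ = div ν`"). [folklore] -/
theorem exists_field_with_bump_divergence {δ : ℝ} (hδ : 0 < δ) (R : ℝ) :
    ∃ (G : (Fin (n + 1) → ℝ) → Fin (n + 1) → ℝ) (φ ψ : (Fin (n + 1) → ℝ) → ℝ),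
      Differentiable ℝ G ∧ Continuous φ ∧ Continuous ψ ∧
      (∀ v, ∑ i, fderiv ℝ G v (Pi.single i 1) i = ψ v) ∧
      (∫ v, φ v = 1) ∧ (∀ v, δ ≤ ‖v‖ → φ v = 0) ∧
      (∀ v : Fin (n + 1) → ℝ, v 0 + δ ≤ R → ψ v = φ v) := by
  -- the one-dimensional bump `θ` and its primitive `Θ`
  let b : ContDiffBump (0 : ℝ) := ⟨δ / 4, δ / 2, by positivity, by linarith⟩
  set θ : ℝ → ℝ := b.normed volume with hθ
  have hθs : ContDiff ℝ ∞ θ := b.contDiff_normed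
  have hθc : Continuous θ := b.continuous_normed
  have hθ0 : ∀ t, δ / 2 ≤ |t| → θ t = 0 := by
    intro t ht
    by_contra h
    have h' : t ∈ support θ := h
    rw [hθ, b.support_normed_eq, mem_ball_zero_iff, Real.norm_eq_abs] at h'
    change |t| < δ / 2 at h'
    linarith
  have hθi : ∫ t, θ t = 1 := b.integral_normed
  set Θ : ℝ → ℝ := fun u => ∫ t in (-δ)..u, θ t with hΘ
  have hΘd : ∀ u, HasDerivAt Θ (θ u) u := fun u =>
    (hθc.integral_hasStrictDerivAt (-δ) u).hasDerivAt
  set A : ℝ → ℝ := fun u => Θ u - Θ (u - R) with hA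
  have hAd : ∀ u, HasDerivAt A (θ u - θ (u - R)) u := fun u =>
    (hΘd u).sub ((hΘd (u - R)).comp_sub_const u R)
  -- the transversal product `B v = ∏_{i ≥ 1} θ (vᵢ)`
  set B : (Fin (n + 1) → ℝ) → ℝ := fun v => ∏ μ : Fin n, θ (v μ.succ) with hB
  have hBs : ContDiff ℝ ∞ B :=
    contDiff_prod fun μ _ => hθs.comp (contDiff_apply ℝ ℝ (Fin.succ μ))
  have hBc : Continuous B := hBs.continuous
  have hBinv : ∀ (v : Fin (n + 1) → ℝ) (t : ℝ),
      B (v + t • (Pi.single 0 1 : Fin (n + 1) → ℝ)) = B v := by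
    intro v t
    simp [hB, Fin.succ_ne_zero]
  -- the scalar potential `g v = A (v 0) * B v` and the field `G = g • e₀`
  set g : (Fin (n + 1) → ℝ) → ℝ := fun v => A (v 0) * B v with hg
  have hAdiff : Differentiable ℝ A := fun u => (hAd u).differentiableAt
  have hgd : Differentiable ℝ g :=
    (hAdiff.comp (differentiable_apply 0)).mul (hBs.differentiable (by simp))
  have hkey : ∀ v : Fin (n + 1) → ℝ,
      fderiv ℝ g v (Pi.single 0 1) = (θ (v 0) - θ (v 0 - R)) * B v := by
    intro v
    rw [← (hgd v).lineDeriv_eq_fderiv]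
    have hpath : (fun t : ℝ => g (v + t • (Pi.single 0 1 : Fin (n + 1) → ℝ))) =
        fun t => A (v 0 + t) * B v := by
      funext t
      simp only [hg, hBinv]
      simp
    have hd : HasDerivAt (fun t : ℝ => g (v + t • (Pi.single 0 1 : Fin (n + 1) → ℝ)))
        ((θ (v 0) - θ (v 0 - R)) * B v) 0 := by
      rw [hpath]
      have h := ((hAd (v 0 + 0)).comp_const_add (v 0) 0).mul_const (B v)
      simpa using h
    exact hd.deriv
  refine ⟨fun v => g v • (Pi.single 0 1 : Fin (n + 1) → ℝ), fun v => θ (v 0) * B v,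
    fun v => (θ (v 0) - θ (v 0 - R)) * B v, ?_, ?_, ?_, ?_, ?_, ?_, ?_⟩
  · exact hgd.smul_const _
  · exact (hθc.comp (continuous_apply 0)).mul hBc
  · exact ((hθc.comp (continuous_apply 0)).sub
      (hθc.comp ((continuous_apply 0).sub continuous_const))).mul hBc
  · intro v
    have hG : fderiv ℝ (fun v => g v • (Pi.single 0 1 : Fin (n + 1) → ℝ)) v =
        (fderiv ℝ g v).smulRight (Pi.single 0 1) :=
      ((hgd v).hasFDerivAt.smul_const _).fderiv
    simp only [hG, ContinuousLinearMap.smulRight_apply, Pi.smul_apply, smul_eq_mul,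
      Pi.single_apply, mul_ite, mul_one, mul_zero, Finset.sum_ite_eq', Finset.mem_univ,
      if_true]
    exact hkey v
  · -- `∫ ∏ θ(vᵢ) = ∏ ∫ θ = 1`
    have h := integral_fintype_prod_volume_eq_prod (fun (_ : Fin (n + 1)) => θ)
    have h' : (fun v : Fin (n + 1) → ℝ => θ (v 0) * B v) =
        fun v => ∏ i : Fin (n + 1), θ (v i) := by
      funext v
      rw [Fin.prod_univ_succ]
    rw [h', h, Finset.prod_eq_one fun _ _ => hθi]
  · intro v hv
    beta_reduce
    -- some coordinate has modulus `≥ δ > δ / 2`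
    by_contra hne
    have hlt : ‖v‖ < δ := by
      rw [pi_norm_lt_iff hδ]
      intro i
      rw [Real.norm_eq_abs]
      by_contra hi
      push Not at hi
      have hθi0 : θ (v i) = 0 := hθ0 (v i) (by linarith)
      apply hne
      rcases Fin.eq_zero_or_eq_succ i with rfl | ⟨j, rfl⟩
      · rw [hθi0, zero_mul]
      · have : B v = 0 := Finset.prod_eq_zero (Finset.mem_univ j) hθi0
        rw [this, mul_zero]
    linarith
  · intro v hv
    beta_reduce
    have : θ (v 0 - R) = 0 := hθ0 _ (by rw [abs_of_nonpos (by linarith)]; linarith)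
    rw [this, sub_zero]

/-! ### The index sum over a period box with interior zeros -/

/-- **Index sum zero, interior form.** Let `f : ℝⁿ⁺¹ → ℝⁿ⁺¹` be `C¹` and `T`-periodic in each
coordinate (`T > 0`), `K = [a, a + T]` a closed period box, and `Z` a finite set of points of the
open box containing all zeros of `f` in `K`, each a non-degenerate zero. Then
`∑_{z ∈ Z} sign det Df(z) = 0` (Poincaré–Hopf on the torus; Chang 2005 §3.1–3.2, degree of a
non-surjective map). [cite: Chang2005, §3.1 Thm 3.1.4 with (3.5)] -/
theorem sum_sign_det_eq_zero_of_zeros_interior {T : ℝ} (hT : 0 < T) (a : Fin (n + 1) → ℝ)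
    {f : (Fin (n + 1) → ℝ) → Fin (n + 1) → ℝ} (hf : ContDiff ℝ 1 f)
    (hper : ∀ x i, f (x + Pi.single i T) = f x) {Z : Finset (Fin (n + 1) → ℝ)}
    (hZU : ∀ z ∈ Z, ∀ i, a i < z i ∧ z i < a i + T)
    (hZ : ∀ x ∈ Icc a (fun i => a i + T), f x = 0 → x ∈ Z) (hZ0 : ∀ z ∈ Z, f z = 0)
    (hnd : ∀ z ∈ Z, (fderiv ℝ f z).det ≠ 0) :
    ∑ z ∈ Z, Real.sign (fderiv ℝ f z).det = 0 := by
  set K : Set (Fin (n + 1) → ℝ) := Icc a (fun i => a i + T) with hK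
  set U : Set (Fin (n + 1) → ℝ) := Set.pi univ fun i => Ioo (a i) (a i + T) with hU
  have hKc : IsCompact K := isCompact_Icc
  have hUo : IsOpen U := isOpen_set_pi finite_univ fun i _ => isOpen_Ioo
  have hUK : U ⊆ K := fun x hx => ⟨fun i => (hx i (mem_univ i)).1.le, fun i => (hx i (mem_univ i)).2.le⟩
  have hZU' : (↑Z : Set (Fin (n + 1) → ℝ)) ⊆ U := fun z hz i _ => hZU z hz i
  obtain ⟨δ, hδ, hloc⟩ := setIntegral_comp_mul_det_eq_integral_mul_sum_sign volume hf hKc hUo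
    hUK hZU' hZ hZ0 hnd
  obtain ⟨M, hM⟩ := hKc.exists_bound_of_continuousOn hf.continuous.continuousOn
  obtain ⟨G, φ, ψ, hG, hφc, hψc, hdiv, hφ1, hφ0, hψφ⟩ :=
    exists_field_with_bump_divergence (n := n) hδ (M + δ)
  have h0 : ∫ x in K, ψ (f x) * (fderiv ℝ f x).det = 0 :=
    integral_divG_comp_mul_det_eq_zero hT.le a hf hper hG hψc hdiv
  have h1 : ∫ x in K, ψ (f x) * (fderiv ℝ f x).det = ∫ x in K, φ (f x) * (fderiv ℝ f x).det := by
    refine setIntegral_congr_fun hKc.measurableSet fun x hx => ?_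
    have hx0 : f x 0 + δ ≤ M + δ := by
      have h := (norm_le_pi_norm (f x) 0).trans (hM x hx)
      rw [Real.norm_eq_abs] at h
      linarith [le_abs_self (f x 0)]
    simp only [hψφ (f x) hx0]
  have h2 := hloc φ hφc hφ0
  rw [hφ1, one_mul] at h2
  rw [← h2, ← h1, h0]

/-! ### Lattice invariance and the count over a half-open fundamental box -/

/-- A function invariant under `x ↦ x + T eᵢ` for every `i` is invariant under the whole lattice
`T ℤⁿ⁺¹`. [folklore] -/
theorem apply_add_intCast_mul_eq {α : Type*} {T : ℝ} {g : (Fin (n + 1) → ℝ) → α}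
    (hper : ∀ x i, g (x + Pi.single i T) = g x) (x : Fin (n + 1) → ℝ) (k : Fin (n + 1) → ℤ) :
    g (x + fun i => (k i : ℝ) * T) = g x := by
  classical
  -- one coordinate, integer multiples
  have h1 : ∀ (x : Fin (n + 1) → ℝ) (i : Fin (n + 1)) (m : ℤ),
      g (x + Pi.single i ((m : ℝ) * T)) = g x := by
    intro x i m
    have hp : Function.Periodic g (Pi.single i T) := fun y => hper y i
    have hm := hp.zsmul m x
    have he : (m • Pi.single i T : Fin (n + 1) → ℝ) = Pi.single i ((m : ℝ) * T) := by
      ext j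
      by_cases hj : j = i
      · subst hj; simp [zsmul_eq_mul]
      · simp [hj]
    rwa [he] at hm
  -- all coordinates, by induction over a finite set of directions
  have h2 : ∀ (s : Finset (Fin (n + 1))) (x : Fin (n + 1) → ℝ),
      g (x + ∑ i ∈ s, Pi.single i ((k i : ℝ) * T)) = g x := by
    intro s
    induction s using Finset.induction_on with
    | empty => intro x; simp
    | insert j s hj ih =>
      intro x
      rw [Finset.sum_insert hj, ← add_assoc, add_right_comm, h1, ih]
  have h3 : (fun i => (k i : ℝ) * T) = ∑ i, Pi.single i ((k i : ℝ) * T) :=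
    (Finset.univ_sum_single _).symm
  rw [h3, h2]

/-- **Poincaré–Hopf on the flat torus (index sum of a periodic vector field).** Let
`f : ℝⁿ⁺¹ → ℝⁿ⁺¹` be `C¹` and `T`-periodic in each coordinate (`T > 0`), and let `S` be the
(finite) set of zeros of `f` in the half-open fundamental box `∏ᵢ [aᵢ, aᵢ + T)`, all
non-degenerate. Then `∑_{x ∈ S} sign det Df(x) = 0`: the numbers of zeros of index `+1` and of
index `-1` agree (`χ(Tⁿ⁺¹) = 0`; Milnor 1965 §6, Chang 2005 §3.1–3.2). Proof: translate the box
to `[c, c + T]` with `cᵢ ∉ {sᵢ + kT}` (a countable set), so that no lattice translate of a zero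
lies on its boundary; reduction modulo `T` (`toIcoMod`) matches the zeros in `[c, c+T]` (all
interior) bijectively with `S`, preserving `Df` by periodicity, and
`sum_sign_det_eq_zero_of_zeros_interior` applies. [cite: Chang2005, §3.1-3.2] -/
theorem sum_sign_det_eq_zero_of_periodic {T : ℝ} (hT : 0 < T) (a : Fin (n + 1) → ℝ)
    {f : (Fin (n + 1) → ℝ) → Fin (n + 1) → ℝ} (hf : ContDiff ℝ 1 f)
    (hper : ∀ x i, f (x + Pi.single i T) = f x) (S : Finset (Fin (n + 1) → ℝ))
    (hS : ∀ x, x ∈ S ↔ (∀ i, x i ∈ Ico (a i) (a i + T)) ∧ f x = 0)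
    (hnd : ∀ x ∈ S, (fderiv ℝ f x).det ≠ 0) :
    ∑ x ∈ S, Real.sign (fderiv ℝ f x).det = 0 := by
  classical
  -- lattice invariance of `f` and `Df`
  have hperD : ∀ x i, fderiv ℝ f (x + Pi.single i T) = fderiv ℝ f x := fun x i =>
    fderiv_periodic_of_periodic (fun y => hper y i) x
  -- reduction modulo `T` into the box based at `c`
  set red : (Fin (n + 1) → ℝ) → (Fin (n + 1) → ℝ) → Fin (n + 1) → ℝ :=
    fun c x i => toIcoMod hT (c i) (x i) with hred
  have hred_lat : ∀ c x, ∃ k : Fin (n + 1) → ℤ, red c x = x + fun i => (k i : ℝ) * T := by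
    intro c x
    refine ⟨fun i => -toIcoDiv hT (c i) (x i), funext fun i => ?_⟩
    have h := toIcoMod_add_toIcoDiv_zsmul hT (c i) (x i)
    rw [zsmul_eq_mul] at h
    simp only [hred, Pi.add_apply, Int.cast_neg, neg_mul]
    linarith
  have hf_red : ∀ c x, f (red c x) = f x := fun c x => by
    obtain ⟨k, hk⟩ := hred_lat c x
    rw [hk, apply_add_intCast_mul_eq hper]
  have hD_red : ∀ c x, fderiv ℝ f (red c x) = fderiv ℝ f x := fun c x => by
    obtain ⟨k, hk⟩ := hred_lat c x
    rw [hk, apply_add_intCast_mul_eq hperD]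
  have hred_mem : ∀ c x i, red c x i ∈ Ico (c i) (c i + T) := fun c x i =>
    toIcoMod_mem_Ico hT (c i) (x i)
  have hred_self : ∀ c x, (∀ i, x i ∈ Ico (c i) (c i + T)) → red c x = x := fun c x hx =>
    funext fun i => (toIcoMod_eq_self hT).2 (hx i)
  have hred_red : ∀ c c' x, red c (red c' x) = red c x := fun c c' x =>
    funext fun i => toIcoMod_toIcoMod hT _ _ _
  -- a box `[c, c + T]` with no lattice translate of a zero on its boundary
  obtain ⟨c, hc⟩ : ∃ c : Fin (n + 1) → ℝ, ∀ i, ∀ s ∈ S, ∀ k : ℤ, s i + k * T ≠ c i := by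
    have h : ∀ i : Fin (n + 1), ∃ c : ℝ, ∀ s ∈ S, ∀ k : ℤ, s i + k * T ≠ c := by
      intro i
      have hBad : (⋃ s ∈ (↑S : Set (Fin (n + 1) → ℝ)), range fun k : ℤ => s i + k * T).Countable :=
        S.countable_toSet.biUnion fun s _ => countable_range _
      obtain ⟨c, hc⟩ := (Set.Countable.dense_compl ℝ hBad).nonempty
      refine ⟨c, fun s hs k h => hc ?_⟩
      exact mem_biUnion (Finset.mem_coe.2 hs) ⟨k, h⟩
    choose c hc using h
    exact ⟨c, hc⟩
  have hS0 : ∀ s ∈ S, f s = 0 := fun s hs => ((hS s).1 hs).2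
  have hSa : ∀ s ∈ S, ∀ i, s i ∈ Ico (a i) (a i + T) := fun s hs => ((hS s).1 hs).1
  -- the reduced zeros lie in the open box at `c`
  have hstrict : ∀ s ∈ S, ∀ i, c i < red c s i ∧ red c s i < c i + T := by
    intro s hs i
    obtain ⟨k, hk⟩ := hred_lat c s
    have hmem := hred_mem c s i
    refine ⟨lt_of_le_of_ne hmem.1 fun heq => hc i s hs (k i) ?_, hmem.2⟩
    have hki := congrFun hk i
    simp only [Pi.add_apply] at hki
    rw [← hki, heq]
  set Zc : Finset (Fin (n + 1) → ℝ) := S.image (red c) with hZc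
  have key := sum_sign_det_eq_zero_of_zeros_interior hT c hf hper (Z := Zc) ?_ ?_ ?_ ?_
  · rw [hZc, Finset.sum_image] at key
    · simpa only [hD_red] using key
    · intro s hs s' hs' h
      have h' := congrArg (red a) h
      rwa [hred_red, hred_red, hred_self a s (hSa s hs), hred_self a s' (hSa s' hs')] at h'
  · intro z hz i
    obtain ⟨s, hs, rfl⟩ := Finset.mem_image.1 hz
    exact hstrict s hs i
  · intro x hx hfx
    have hxS : red a x ∈ S := (hS _).2 ⟨fun i => hred_mem a x i, by rw [hf_red]; exact hfx⟩
    have hxc : ∀ i, x i ∈ Ico (c i) (c i + T) := by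
      intro i
      refine ⟨hx.1 i, lt_of_le_of_ne (hx.2 i) fun heq => ?_⟩
      obtain ⟨k, hk⟩ := hred_lat a x
      have hki := congrFun hk i
      simp only [Pi.add_apply] at hki
      apply hc i (red a x) hxS (-(k i) - 1)
      push_cast
      have : x i = c i + T := heq
      rw [hki, this]
      ring
    have hx' : red c (red a x) = x := by rw [hred_red, hred_self c x hxc]
    rw [← hx']
    exact Finset.mem_image_of_mem _ hxS
  · intro z hz
    obtain ⟨s, hs, rfl⟩ := Finset.mem_image.1 hz
    rw [hf_red]
    exact hS0 s hs
  · intro z hz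
    obtain ⟨s, hs, rfl⟩ := Finset.mem_image.1 hz
    rw [hD_red]
    exact hnd s hs

end Literature.Topology.Euclidean
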